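import Summits.AnomalousDissipation.AnomalousDissipation.Theses.SteadyCoherentFraction

/-!
# Glue of the birth split of `SteadyCoherentFraction.RootsPlanar` (stmt-AnomalousDissipation-28522)

Sorry-free proof of the GLUE item `SteadyCoherentFraction.RootsCutGlue` (stmt-AnomalousDissipation-28531):
`FiniteModeRootsPlanar → RootsPlanarBeyondFiniteModes → RootsPlanar` — excluded middle on the Fourier type of the root
(finite type: the rung F 27870; infinite type: the residual of record R_∞ 28530), plus the EXACTNESS of the cut
`RootsPlanar ↔ FiniteModeRootsPlanar ∧ RootsPlanarBeyondFiniteModes`.  No facts are asserted.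
Source: decomp-ad cell, lens-4 g19 node «SteadyCoherentFraction» (kernel `rootsCutGlue_holds`, `rootsPlanar_iff`); landed by the cell's prover seat.
-/

set_option linter.dupNamespace false

namespace Summit.AnomalousDissipation.AnomalousDissipation.Theorems.RootsCutGlue

open Summit.AnomalousDissipation.AnomalousDissipation.Theses.SteadyCoherentFraction

/-- The GLUE item `SteadyCoherentFraction.RootsCutGlue` (stmt-AnomalousDissipation-28531) holds: case split on the Fourier type. [folklore] -/
theorem rootsCutGlue_holds : RootsCutGlue := by
  intro hF hB m R v hR hst
  by_cases hfin : ∃ N : ℕ, ((v : MeasureTheory.Lp (EuclideanSpace ℝ (Fin 3)) 2 (MeasureTheory.volume : MeasureTheory.Measure (UnitAddTorus (Fin 3)))) : UnitAddTorus (Fin 3) → EuclideanSpace ℝ (Fin 3)) =ᵐ[MeasureTheory.volume] Literature.Analysis.FunctionSpaces.Torus.fourierTruncate N ((v : MeasureTheory.Lp (EuclideanSpace ℝ (Fin 3)) 2 (MeasureTheory.volume : MeasureTheory.Measure (UnitAddTorus (Fin 3)))) : UnitAddTorus (Fin 3) → EuclideanSpace ℝ (Fin 3))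
  · exact hF m R v hfin hR hst
  · exact hB m R v hfin hR hst

/-- EXACTNESS of the birth cut: `RootsPlanar` (28522) ⟺ F (27870) ∧ R_∞ (28530). [folklore] -/
theorem rootsPlanar_iff_pieces : RootsPlanar ↔ (FiniteModeRootsPlanar ∧ RootsPlanarBeyondFiniteModes) :=
  ⟨fun h => ⟨fun m R v _ hR hst => h m R v hR hst, fun m R v _ hR hst => h m R v hR hst⟩,
   fun h => rootsCutGlue_holds h.1 h.2⟩

end Summit.AnomalousDissipation.AnomalousDissipation.Theorems.RootsCutGlue
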